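import Mathlib
import Summits.NavierStokesRegularity.NavierStokesRegularity.Theorems.ScenarioCensusHelicalSlabTerms
import Summits.NavierStokesRegularity.NavierStokesRegularity.Theorems.ScenarioCensusHelicalSlabFlux
import Summits.NavierStokesRegularity.NavierStokesRegularity.Theorems.ScenarioCensusHelicalSlabPeriodicPressure
import Summits.NavierStokesRegularity.NavierStokesRegularity.Theorems.ScenarioCensusPeriodicSlabHelical
import Literature.Analysis.FluidPDE.SteadyNSLiouvilleLpDirichlet
import HarnessLib

/-!
# Census row S6: the Liouville theorem for bounded helically symmetric steady flows
# (Han–Wang–Xie 2023, Thm 1.1), any period–Reynolds number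

Support file for the scenario census of `NavierStokesRegularity` (cell `pub/ns-census`, block S).
**Theorem** (J. Han, Y. Wang, C. Xie, arXiv:2312.10382 = Sci. China Math. 69 (2025), Thm 1.1; the
tree FACT `Literature.Analysis.FluidPDE.HanWangXie2023_helical_liouville`, verbatim): for every
`ν > 0` and pitch `κ ≠ 0`, a smooth steady Navier–Stokes flow `(U, P)` on `ℝ³`
(`IsLerayProfile ν 0 U P`, `U, P ∈ C^∞`), bounded and helically symmetric
(`IsHelicallySymmetric κ U`), is an axial constant `U ≡ C e₃` (`helical_liouville`). The small
period–Reynolds sub-case (`sup ‖U‖ < ν/|κ|`) was `PeriodicSlab.helical_liouville_small`; here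
NO smallness is assumed.

Proof (the printed §3, assembled from the sibling files, with the Bogovskiĭ corrector replaced by
the foot-point splitting of the pressure): normalise `ν = 1`
(`IsLerayProfile.inv_smul_viscosity`); the flow is `2π|κ|`-periodic along the axis
(`…PeriodicSlabHelical`), all derivatives and `∇P` are bounded (`…PeriodicSlabRegularity`), the
pressure is periodic (`steady_pressure_periodic`, HWX Lemma 2.7), the radial velocity `⟪x_h, U⟫`
has zero vertical period means (`helical_radial_verticalMean_eq_zero`, HWX (A117)); hence the
dyadic energy inequality `E(r) ≤ a λ r + c (E(2r) − E(r))/(λ r)`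
(`helical_dyadic_weighted_estimate`) for the period energy `E(r) = ∫_{zSlab ∩ {ρ<r}} |DU|²`, so
`E ≡ 0` by the dyadic Saint-Venant lemma (`saintVenant_dyadic`, `γ = 0`), `DU ≡ 0`, `U` is
constant, and a helically symmetric constant is axial (half turn).

No summit statement is proved in this file; the census value of row S6 is the lead's call
(the by-name closer `row_S6_excluded` is the leaf file `ScenarioCensusSteadyS6.lean`).

## References

* J. Han, Y. Wang, C. Xie, arXiv:2312.10382 (2023) = Sci. China Math. 69 (2025), Thm 1.1, §3.
  [HanWangXie2023] [HanWangXie2025]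
* J. Bang, C. Gui, Y. Wang, C. Xie, J. Fluid Mech. 1005 (2025) A6 = arXiv:2205.13259.
  [BangGuiWangXie2025]
-/

-- the summit and its single problem share the name (D-0017 nested layout)
set_option linter.dupNamespace false

noncomputable section

open MeasureTheory Set Function Filter InnerProductSpace
open scoped Topology ENNReal NNReal RealInnerProductSpace Laplacian ContDiff

namespace Summit.NavierStokesRegularity.NavierStokesRegularity.Theorems.ScenarioCensus.HelicalSlab

open Literature.Analysis Literature.Analysis.FluidPDE
open Summit.NavierStokesRegularity.NavierStokesRegularity.Theorems.ScenarioCensus.PeriodicSlab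

/-! ### Pointwise bookkeeping -/

/-- A linear map on `ℝ³` with vanishing Frobenius norm vanishes. -/
theorem eq_zero_of_frobeniusNormSq_eq_zero {T : EuclideanSpace ℝ (Fin 3) →L[ℝ] EuclideanSpace ℝ (Fin 3)}
    (hT : frobeniusNormSq T = 0) : T = 0 := by
  set b := EuclideanSpace.basisFun (Fin 3) ℝ with hb
  have hcoord : ∀ i, T (b i) = 0 := fun i => by
    have h1 := norm_apply_sq_le_frobeniusNormSq b T i
    rw [hT] at h1
    have h3 : ‖T (b i)‖ ^ 2 = 0 := le_antisymm h1 (sq_nonneg _)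
    exact norm_eq_zero.1 (pow_eq_zero_iff two_ne_zero |>.1 h3)
  ext v
  have hv : v = ∑ i, ⟪b i, v⟫ • b i := (b.sum_repr' v).symm
  rw [hv, map_sum]
  simp [map_smul, hcoord]

/-! ### The dyadic estimate in energy form -/

/-- **The dyadic energy estimate** for a smooth steady flow at unit viscosity, axially periodic
with periodic pressure, bounded with bounded gradient and pressure gradient, and mean-free radial
velocity on vertical periods (`‖U‖ ≤ M`, `|DU|² ≤ B`, `‖DP‖ ≤ K₃`): with
`E(r) = ∫_{zSlab L 0 ∩ {ρ<r}} |DU|²` there are `a, c ≥ 0` with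
`E(r) ≤ a λ r + c (E(2r) − E(r))/(λ r)` for all `r ≥ 1`, `λ > 0`. -/
theorem helical_energy_dyadic_estimate {L M K₃ B : ℝ} (hL : 0 < L)
    {U : EuclideanSpace ℝ (Fin 3) → EuclideanSpace ℝ (Fin 3)} {P : EuclideanSpace ℝ (Fin 3) → ℝ}
    (h : IsLerayProfile 1 0 U P) (hU : ContDiff ℝ (⊤ : ℕ∞) U) (hP : ContDiff ℝ (⊤ : ℕ∞) P)
    (hUper : IsAxiallyPeriodic L U) (hPper : IsAxiallyPeriodic L P)
    (hM : ∀ x, ‖U x‖ ≤ M) (hB : ∀ x, frobeniusNormSq (fderiv ℝ U x) ≤ B)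
    (hK₃ : ∀ x, ‖fderiv ℝ P x‖ ≤ K₃)
    (hmean : ∀ x, ∫ s in (0 : ℝ)..L, ⟪horizPart x, U (x + s • eZ)⟫ = 0)
    (E : ℝ → ℝ) (hE : ∀ r, E r = ∫ x in zSlab L 0 ∩ {x | cylRadius x < r},
      frobeniusNormSq (fderiv ℝ U x)) :
    ∃ a c : ℝ, 0 ≤ a ∧ 0 ≤ c ∧ ∀ r : ℝ, 1 ≤ r → ∀ lam : ℝ, 0 < lam →
      1 * E r ≤ 0 * (E (2 * r) - E r) / r + a * lam * r + c * (E (2 * r) - E r) / (lam * r) := by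
  obtain ⟨C₀, hC₀0, hC₀⟩ := exists_norm_gradient_cylCutoff_le
  set κ : ℝ := (L / (2 * Real.pi)) ^ 2 with hκ
  have hκ0 : 0 ≤ κ := sq_nonneg _
  have hM0 : 0 ≤ M := (norm_nonneg _).trans (hM 0)
  have hK₃0 : 0 ≤ K₃ := (norm_nonneg _).trans (hK₃ 0)
  have hU1 : ContDiff ℝ 1 U := contDiff_infty.1 hU 1
  set F : EuclideanSpace ℝ (Fin 3) → ℝ := fun x => frobeniusNormSq (fderiv ℝ U x) with hF
  have hFc : Continuous F := continuous_frobeniusNormSq_fderiv hU1 one_ne_zero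
  have hF0 : ∀ x, 0 ≤ F x := fun x => frobeniusNormSq_nonneg _
  refine ⟨96 * C₀ * M * L + 8 * C₀ * M ^ 2 * L + 16 * C₀ * K₃ * L ^ 2,
    3 * C₀ * M + C₀ * M ^ 2 * κ + 2 * C₀ * K₃ * L * κ, by positivity, by positivity, ?_⟩
  intro r hr lam hlam
  have hr0 : 0 < r := by linarith
  have hr2 : r < 2 * r := by linarith
  have hA := helical_dyadic_weighted_estimate hL h hU hP hUper hPper hM hK₃ hB hmean hC₀ hr hlam
  -- abbreviations
  set S : Set (EuclideanSpace ℝ (Fin 3)) := zSlab L 0 with hS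
  set φ : EuclideanSpace ℝ (Fin 3) → ℝ := cylCutoff r (2 * r) with hφ
  set A : Set (EuclideanSpace ℝ (Fin 3)) := {x | r ≤ cylRadius x ∧ cylRadius x < 2 * r} with hAdef
  set χ : EuclideanSpace ℝ (Fin 3) → ℝ := A.indicator fun _ => (1 : ℝ) with hχ
  set Iφ : ℝ := ∫ x in S, φ x * F x with hIφ
  set D : ℝ := ∫ x in S, χ x * F x with hD
  have hφc : Continuous φ := (contDiff_cylCutoff r (2 * r) (n := 0)).continuous
  have hφnn : ∀ x, 0 ≤ φ x := cylCutoff_nonneg r (2 * r)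
  have hφone : ∀ x, cylRadius x ≤ r → φ x = 1 := fun x hx => cylCutoff_eq_one hr0.le hr2 hx
  have hφzero : ∀ x, 2 * r ≤ cylRadius x → φ x = 0 := fun x hx => cylCutoff_eq_zero hr0.le hr2 hx
  have hAm : MeasurableSet A :=
    (isClosed_le continuous_const continuous_cylRadius).measurableSet.inter
      (isOpen_lt continuous_cylRadius continuous_const).measurableSet
  have hIφ_int : IntegrableOn (fun x => φ x * F x) S volume :=
    integrableOn_zSlab_of_eq_zero_of_le_cylRadius (Q := fun x => φ x * F x) (hφc.mul hFc)
      (fun x hx => by show φ x * F x = 0; rw [hφzero x hx, zero_mul]) L 0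
  have hF_int2 : IntegrableOn F (S ∩ {x | cylRadius x < 2 * r}) volume :=
    integrableOn_zSlab_inter_cyl_of_bound hL (by linarith) hFc (B := B) fun x => by
      rw [Real.norm_of_nonneg (hF0 x)]; exact hB x
  have hmeas : MeasurableSet (S ∩ {x : EuclideanSpace ℝ (Fin 3) | cylRadius x < r}) :=
    (measurableSet_zSlab L 0).inter (isOpen_lt continuous_cylRadius continuous_const).measurableSet
  have hsub : S ∩ {x | cylRadius x < r} ⊆ S ∩ {x | cylRadius x < 2 * r} :=
    fun x hx => ⟨hx.1, lt_trans hx.2 hr2⟩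
  -- `E(r) ≤ Iφ`
  have hEr : E r ≤ Iφ := by
    rw [hE r]
    calc ∫ x in S ∩ {x | cylRadius x < r}, F x
        = ∫ x in S, (S ∩ {x | cylRadius x < r}).indicator F x := by
          rw [setIntegral_indicator hmeas, Set.inter_eq_self_of_subset_right inter_subset_left]
      _ ≤ Iφ := by
          refine setIntegral_mono_on ((hF_int2.mono_set hsub).integrable_indicator hmeas |>.integrableOn)
            hIφ_int (measurableSet_zSlab L 0) fun x _ => ?_
          by_cases hx : x ∈ S ∩ {x | cylRadius x < r}
          · rw [Set.indicator_of_mem hx, hφone x (le_of_lt hx.2), one_mul]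
          · rw [Set.indicator_of_notMem hx]; exact mul_nonneg (hφnn x) (hF0 x)
  -- `E(2r) − E(r) = D`
  have hED : E (2 * r) - E r = D := by
    rw [hE (2 * r), hE r, hD]
    have hdiff : (S ∩ {x | cylRadius x < 2 * r}) \ (S ∩ {x | cylRadius x < r}) = S ∩ A := by
      ext x
      constructor
      · rintro ⟨⟨hxS, hx2⟩, hnot⟩
        refine ⟨hxS, ?_, hx2⟩
        by_contra hlt
        exact hnot ⟨hxS, not_le.1 hlt⟩
      · rintro ⟨hxS, h1, h2⟩
        exact ⟨⟨hxS, h2⟩, fun h' => (not_lt.2 h1) h'.2⟩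
    rw [← setIntegral_sdiff hmeas hF_int2 hsub, hdiff, ← setIntegral_indicator hAm]
    refine setIntegral_congr_fun (measurableSet_zSlab L 0) fun x _ => ?_
    by_cases hx : x ∈ A
    · simp [hχ, hx]
    · simp [hχ, hx]
  rw [one_mul, zero_mul, zero_div, zero_add, hED]
  exact hEr.trans hA

/-! ### The Liouville theorem -/

/-- **Han–Wang–Xie 2023, Thm 1.1, at unit viscosity.** A smooth steady Navier–Stokes flow on
`ℝ³` with `ν = 1` (`IsLerayProfile 1 0 U P`, `U, P ∈ C^∞`), bounded and helically symmetric of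
pitch `κ ≠ 0`, is an axial constant. -/
theorem helical_liouville_one {κ : ℝ} (hκ : κ ≠ 0)
    {U : EuclideanSpace ℝ (Fin 3) → EuclideanSpace ℝ (Fin 3)} {P : EuclideanSpace ℝ (Fin 3) → ℝ}
    (hprof : IsLerayProfile 1 0 U P) (hU : ContDiff ℝ (⊤ : ℕ∞) U) (hP : ContDiff ℝ (⊤ : ℕ∞) P)
    (hbd : ∃ M : ℝ, ∀ x, ‖U x‖ ≤ M) (hsym : IsHelicallySymmetric κ U) :
    ∃ C : ℝ, U = fun _ => C • eZ := by
  obtain ⟨M, hM⟩ := hbd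
  have hst : IsSteadyClassicalNS 1 0 U P := isSteadyClassicalNS_of_isLerayProfile hprof hU hP
  -- axial period `L = 2π|κ|`
  set L : ℝ := 2 * Real.pi * |κ| with hL
  have hL0 : 0 < L := by rw [hL]; positivity
  have hper : IsAxiallyPeriodic L U := by
    have h1 := isAxiallyPeriodic_of_isHelicallySymmetric hsym
    rcases le_or_gt 0 κ with hk | hk
    · rw [hL, abs_of_nonneg hk]; exact h1
    · rw [hL, abs_of_neg hk, show 2 * Real.pi * -κ = -(2 * Real.pi * κ) by ring]
      exact isAxiallyPeriodic_neg h1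
  -- periodic pressure, derivative bounds
  have hPper : IsAxiallyPeriodic L P := steady_pressure_periodic hL0 hst hM hper
  obtain ⟨K₁, K₂, K₃, -, -, -, hK⟩ := steady_derivative_bounds one_pos hst hM
  have hK₁ : ∀ x, ‖fderiv ℝ U x‖ ≤ K₁ := fun x => (hK x).1
  have hK₃ : ∀ x, ‖fderiv ℝ P x‖ ≤ K₃ := fun x => by
    have e : ‖fderiv ℝ P x‖ = ‖gradient P x‖ := by
      rw [gradient]; exact ((InnerProductSpace.toDual ℝ (EuclideanSpace ℝ (Fin 3))).symm.norm_map _).symm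
    rw [e]; exact (hK x).2.2
  have hU1 : ContDiff ℝ 1 U := contDiff_infty.1 hU 1
  have hUd : Differentiable ℝ U := hU1.differentiable one_ne_zero
  -- the helical flux lemma
  have hmean := helical_radial_verticalMean_eq_zero hU1 hK₁ hst.divFree hper hsym
  -- the period energies
  set F : EuclideanSpace ℝ (Fin 3) → ℝ := fun x => frobeniusNormSq (fderiv ℝ U x) with hF
  set E : ℝ → ℝ := fun r => ∫ x in zSlab L 0 ∩ {x | cylRadius x < r}, F x with hE
  have hFc : Continuous F := continuous_frobeniusNormSq_fderiv hU1 one_ne_zero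
  have hF0 : ∀ x, 0 ≤ F x := fun x => frobeniusNormSq_nonneg _
  -- `|DU|² ≤ 3 ‖DU‖² ≤ 3 K₁²` (Frobenius versus operator norm; inlined)
  set b := EuclideanSpace.basisFun (Fin 3) ℝ with hb
  have hFB' : ∀ x, F x ≤ 3 * K₁ ^ 2 := fun x => by
    show frobeniusNormSq (fderiv ℝ U x) ≤ 3 * K₁ ^ 2
    rw [frobeniusNormSq_eq_sum b]
    calc ∑ i, ‖fderiv ℝ U x (b i)‖ ^ 2 ≤ ∑ _i : Fin 3, K₁ ^ 2 := Finset.sum_le_sum fun i _ => by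
          have h1 : ‖fderiv ℝ U x (b i)‖ ≤ K₁ := by
            calc ‖fderiv ℝ U x (b i)‖ ≤ ‖fderiv ℝ U x‖ * ‖b i‖ := ContinuousLinearMap.le_opNorm _ _
              _ ≤ K₁ := by rw [b.orthonormal.1 i, mul_one]; exact hK₁ x
          exact pow_le_pow_left₀ (norm_nonneg _) h1 2
      _ = 3 * K₁ ^ 2 := by simp
  have hFB : ∀ x, ‖F x‖ ≤ 3 * K₁ ^ 2 := fun x => by
    rw [Real.norm_of_nonneg (hF0 x)]; exact hFB' x
  obtain ⟨a, c, ha, hc, hineq⟩ := helical_energy_dyadic_estimate hL0 hprof hU hP hper hPper hM hFB'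
    hK₃ hmean E (fun r => rfl)
  have hFper : IsAxiallyPeriodic L F := fun x => by
    simp only [hF, isAxiallyPeriodic_fderiv hper x]
  have hEint : ∀ r, 0 < r → IntegrableOn F (zSlab L 0 ∩ {x | cylRadius x < r}) volume :=
    fun r hr => integrableOn_zSlab_inter_cyl_of_bound hL0 hr hFc hFB
  have hmono : ∀ r s, 1 ≤ r → r ≤ s → E r ≤ E s := fun r s hr hrs =>
    setIntegral_mono_set (hEint s (by linarith)) (Eventually.of_forall fun x => hF0 x)
      (Eventually.of_forall fun x hx => ⟨hx.1, lt_of_lt_of_le hx.2 hrs⟩)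
  have hE0 : ∀ r, 1 ≤ r → 0 ≤ E r := fun r _ =>
    setIntegral_nonneg ((measurableSet_zSlab L 0).inter
      (isOpen_lt continuous_cylRadius continuous_const).measurableSet) fun x _ => hF0 x
  have hEA : ∀ r, 1 ≤ r → E r ≤ 3 * K₁ ^ 2 * (8 * L) * r ^ 2 := by
    intro r hr
    have hr0 : 0 < r := by linarith
    have hvol := volume_zSlab_inter_cyl_le hL0 hr0
    have hfin : volume (zSlab L 0 ∩ {x | cylRadius x < r}) ≠ ⊤ :=
      (lt_of_le_of_lt hvol ENNReal.ofReal_lt_top).ne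
    have hmeas : MeasurableSet (zSlab L 0 ∩ {x : EuclideanSpace ℝ (Fin 3) | cylRadius x < r}) :=
      (measurableSet_zSlab L 0).inter (isOpen_lt continuous_cylRadius continuous_const).measurableSet
    calc E r ≤ ∫ x in zSlab L 0 ∩ {x | cylRadius x < r}, (3 * K₁ ^ 2 : ℝ) := by
          refine setIntegral_mono_on (hEint r hr0) ?_ hmeas fun x _ => ?_
          · exact integrableOn_const hfin
          · have := hFB x; rwa [Real.norm_of_nonneg (hF0 x)] at this
      _ = (volume (zSlab L 0 ∩ {x | cylRadius x < r})).toReal * (3 * K₁ ^ 2) := by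
          rw [setIntegral_const, smul_eq_mul, measureReal_def]
      _ ≤ (8 * L * r ^ 2) * (3 * K₁ ^ 2) :=
          mul_le_mul_of_nonneg_right (ENNReal.toReal_le_of_le_ofReal (by positivity) hvol)
            (by positivity)
      _ = 3 * K₁ ^ 2 * (8 * L) * r ^ 2 := by ring
  -- `E ≡ 0` by the dyadic lemma (`γ = 0`)
  have hEzero : ∀ r, 1 ≤ r → E r = 0 :=
    saintVenant_dyadic one_pos le_rfl ha hc hmono hE0 hEA hineq
  -- `DU ≡ 0`, `U` constant
  have hFzero : ∀ x, F x = 0 :=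
    eq_zero_of_setIntegral_zSlab_eq_zero hL0 hFc hF0 hFper hFB hEzero
  have hDU : ∀ x, fderiv ℝ U x = 0 := fun x => eq_zero_of_frobeniusNormSq_eq_zero (hFzero x)
  have hconst : ∀ x, U x = U 0 := fun x => is_const_of_fderiv_eq_zero hUd hDU x 0
  -- a helically symmetric constant field is axial (half turn)
  set C : EuclideanSpace ℝ (Fin 3) := U 0 with hC
  have hrot : rotZ Real.pi C = C := by
    have h := hsym Real.pi 0
    rw [hconst (rotZ Real.pi 0 + (κ * Real.pi) • eZ)] at h
    exact h.symm
  have hC0 : C 0 = 0 := by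
    have h0 := congrArg (fun v : EuclideanSpace ℝ (Fin 3) => v 0) hrot
    simp only [rotZ_apply_zero, Real.cos_pi, Real.sin_pi] at h0
    linarith
  have hC1 : C 1 = 0 := by
    have h1 := congrArg (fun v : EuclideanSpace ℝ (Fin 3) => v 1) hrot
    simp only [rotZ_apply_one, Real.cos_pi, Real.sin_pi] at h1
    linarith
  refine ⟨C 2, funext fun x => ?_⟩
  rw [hconst x]
  ext i
  fin_cases i <;> simp [eZ, hC0, hC1]

/-- **The Liouville theorem for bounded helically symmetric steady flows (Han–Wang–Xie 2023,
Thm 1.1), any viscosity `ν > 0`, any period–Reynolds number.** For `ν > 0` and `κ ≠ 0`, a smooth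
steady solution `(U, P)` of the unforced Navier–Stokes system on `ℝ³` (`IsLerayProfile ν 0 U P`,
`U, P ∈ C^∞`) with `U` bounded and helically symmetric (`IsHelicallySymmetric κ U`) is an axial
constant `U ≡ C e₃`. This is the statement of the named fact
`Literature.Analysis.FluidPDE.HanWangXie2023_helical_liouville` under its hypotheses. -/
theorem helical_liouville {ν κ : ℝ} (hν : 0 < ν) (hκ : κ ≠ 0)
    {U : EuclideanSpace ℝ (Fin 3) → EuclideanSpace ℝ (Fin 3)} {P : EuclideanSpace ℝ (Fin 3) → ℝ}
    (hprof : IsLerayProfile ν 0 U P) (hU : ContDiff ℝ (⊤ : ℕ∞) U) (hP : ContDiff ℝ (⊤ : ℕ∞) P)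
    (hbd : ∃ M : ℝ, ∀ x, ‖U x‖ ≤ M) (hsym : IsHelicallySymmetric κ U) :
    ∃ C : ℝ, U = fun _ => C • eZ := by
  obtain ⟨M, hM⟩ := hbd
  -- normalise the viscosity
  set V : EuclideanSpace ℝ (Fin 3) → EuclideanSpace ℝ (Fin 3) := fun x => ν⁻¹ • U x with hV
  set Q : EuclideanSpace ℝ (Fin 3) → ℝ := fun x => ν⁻¹ ^ 2 • P x with hQ
  have hprof1 : IsLerayProfile 1 0 V Q := hprof.inv_smul_viscosity hν.ne'
  have hVs : ContDiff ℝ (⊤ : ℕ∞) V := hU.const_smul ν⁻¹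
  have hQs : ContDiff ℝ (⊤ : ℕ∞) Q := hP.const_smul (ν⁻¹ ^ 2)
  have hVbd : ∃ M' : ℝ, ∀ x, ‖V x‖ ≤ M' := ⟨|ν⁻¹| * M, fun x => by
    show ‖ν⁻¹ • U x‖ ≤ |ν⁻¹| * M
    rw [norm_smul, Real.norm_eq_abs]
    exact mul_le_mul_of_nonneg_left (hM x) (abs_nonneg _)⟩
  have hVsym : IsHelicallySymmetric κ V := fun ρ x => by
    show ν⁻¹ • U (rotZ ρ x + (κ * ρ) • eZ) = rotZ ρ (ν⁻¹ • U x)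
    rw [hsym ρ x]
    exact ((rotZL ρ).map_smul ν⁻¹ (U x)).symm
  obtain ⟨C, hC⟩ := helical_liouville_one hκ hprof1 hVs hQs hVbd hVsym
  refine ⟨ν * C, funext fun x => ?_⟩
  have hx : ν⁻¹ • U x = C • eZ := congrFun hC x
  have := congrArg (fun v => ν • v) hx
  simpa [smul_smul, mul_inv_cancel₀ hν.ne'] using this

end Summit.NavierStokesRegularity.NavierStokesRegularity.Theorems.ScenarioCensus.HelicalSlab

end
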